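import Literature.NumberTheory.Sieve.MoebiusShiftedPrimesMinorArc
import HarnessLib

/-!
# Möbius on shifted primes — display (3.1) of Lichtman 2020, proved

Topic `Literature/NumberTheory/Sieve`.  This file DISCHARGES the named fact
`Literature.NumberTheory.Sieve.Lichtman2020_minorArcBound31` (`MoebiusShiftedPrimesMinorArcForm.lean`), display (3.1) of
J. D. Lichtman, *Averages of the Möbius function on shifted primes*, Q. J. Math. 73 (2022),
doi:10.1093/qmath/haab054, arXiv:2009.08969 [Lichtman2020], §3.1, p. 9 of the held copy
`paper:arxiv-2009.08969`:
`I_𝔪 ≪ HX (log log X/(dW))^{1/2} ψ(X)` uniformly for `α ∈ 𝔪`, `d ≤ W = (log X)^A`, `g` completely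
multiplicative with `|g| ≤ 1` (`ψ(X) = log H/log log X`).

## The proof and the one deviation from `MoebiusShiftedPrimesMinorArc.lean`

`MoebiusShiftedPrimesMinorArc.lean` proves the whole of §3.1 in discrete form (Ramaré's identity (3.2),
dyadic blocks, duality and Cauchy–Schwarz (3.4)–(3.5), geometric series, Vinogradov's lemma,
Chebyshev's bound for the primes of a block) with the final shape `600 · HX log H/(d√W)`, which is
too weak for (3.1) at small `d` by a factor `√(log log X)`: the logarithm `1 + log(Q₁ · 2P)` of the
explicit Vinogradov lemma `Literature.NumberTheory.Sieve.Vinogradov.sum_geomBound_div_le` (majorant `min(N/k, ·)`) costs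
`√(log H)` per block.  The sums that actually occur in (3.5)–(3.6) carry the CONSTANT majorant
`min(U, 1/(2‖nα‖))`, `U = H/(dP) + 1` the length of the `m`-interval, and for it Vinogradov's lemma
holds in the printed log-free shape of Lemma 3.3, "`≪ H/q + H/P + (P + q) log q`":
`∑_{n ≤ N} min(U, 1/(2‖nα‖)) ≤ 4NU/q + 2U + (4N + 2q)(1 + log q)` (`sum_geomBound_const_le_of_abs_le`:
blocks of `⌊q/2⌋ + 1` consecutive `n`, inside which the points `nα` are `1/(2q)`-separated).  Feeding
this into the unchanged block machinery gives `94 · HX/(d√W) · (j+1)^{-1/2}` for the block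
`P = 2^j` (`block_bound_sharp`), hence `∑_k |…| ≤ 384 · HX √(log H)/(d√W)` (`minorArc_sum_le_sharp`,
`∑_{j ≤ J} (j+1)^{-1/2} ≤ 2√(J+1) ≤ 4√(log H)`; the Ramaré error is `≤ 8HX/(d√W)`,
`ramare_error_le_sharp`), and finally (3.1) with `C = 384`, because
`√(log H)/(d√W) ≤ (log log X/(dW))^{1/2} · log H/log log X ⟺ log log X ≤ d log H`, which holds as
soon as `ψ(X) ≥ 1` (`Lichtman2020_minorArcBound31_holds`).  As in `MoebiusShiftedPrimesMinorArc.lean`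
the prime-pair sieve bound of (3.6) [Opera de Cribro] is replaced by the trivial injectivity count;
the saving `1/d` (for the printed `1/√d`) absorbs the difference.

## Contents

* `Lichtman2020.sum_geomBound_const_le_of_abs_le`, `Lichtman2020.sum_geomBound_const_le_of_mem_minorArcs_sharp`
  — Lemma 3.3 for the constant majorant, log-free on the main term.
* `Lichtman2020.block_numeric_bound_sharp`, `Lichtman2020.ramare_error_le_sharp`,
  `Lichtman2020.block_bound_sharp`, `Lichtman2020.minorArc_sum_le_sharp`,
  `Lichtman2020.minorArc_integral_le_sharp` — the chain of `MoebiusShiftedPrimesMinorArc.lean` with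
  the improved Vinogradov input.
* `Lichtman2020_minorArcBound31_holds : Lichtman2020_minorArcBound31` — display (3.1), PROVED.

## Source

* J. D. Lichtman, arXiv:2009.08969, §3.1 pp. 9–10: display (3.1), (3.2)–(3.6), Lemma 3.3.
* M. B. Nathanson, *Additive Number Theory: The Classical Bases*, §4.4 (Lemmas 4.8–4.10), through
  `VinogradovExpSumTools.lean`.
-/

open Filter Finset MeasureTheory
open scoped FourierTransform Topology

namespace Literature.NumberTheory.Sieve.Lichtman2020

/-! ### Vinogradov's lemma for the constant majorant, log-free on the main term -/

/-- **Lemma 3.3 for the constant majorant** (the shape printed on p. 10: "`≪ H/q + H/P + (P+q) log q`",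
with no logarithm on the first term): if `|α - a/q| ≤ q⁻²`, `(a, q) = 1`, `q ≥ 1`, then for
`V ≥ 0` and every `U`,
`∑_{1 ≤ k ≤ U} min(V, 1/(2‖kα‖)) ≤ (2U/q + 1)(2V + 2q(1 + log q))`.
Proof: split `[1, U]` into the blocks `{k : ⌊k/L⌋ = j}` of `L = ⌊q/2⌋ + 1` consecutive integers;
inside a block the points `kα` are `1/(2q)`-separated (`Vinogradov.le_distInt_mul_of_abs_le`), so a
block contributes at most `2V + 2q(1 + log q)` (`Vinogradov.sum_geomBound_le_of_separated`), and there
are `≤ U/L + 1 ≤ 2U/q + 1` blocks. [cite: Lichtman2020, Lemma 3.3] -/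
theorem sum_geomBound_const_le_of_abs_le {α : ℝ} {a : ℤ} {q : ℕ} (hq : 1 ≤ q)
    (hcop : IsCoprime a q) (hα : |α - a / q| ≤ 1 / (q : ℝ) ^ 2) {V : ℝ} (hV : 0 ≤ V) (U : ℕ) :
    ∑ k ∈ Icc 1 U, Vinogradov.geomBound V ((k : ℝ) * α) ≤
      (2 * U / q + 1) * (2 * V + 2 * q * (1 + Real.log q)) := by
  classical
  have hq0 : (0 : ℝ) < q := by exact_mod_cast hq
  have hU0 : (0 : ℝ) ≤ U := Nat.cast_nonneg U
  set L : ℕ := q / 2 + 1 with hL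
  have hL1 : 1 ≤ L := by omega
  have hLpos : 0 < L := hL1
  have hL0 : (0 : ℝ) < L := by exact_mod_cast hL1
  have hqL : (q : ℝ) < 2 * L := by
    have : q < 2 * L := by omega
    exact_mod_cast this
  have hLq : ((L : ℕ) : ℝ) - 1 ≤ (q : ℝ) / 2 := by
    have : ((q / 2 : ℕ) : ℝ) ≤ (q : ℝ) / 2 := Nat.cast_div_le
    rw [hL]; push_cast; linarith
  have hδ : (0 : ℝ) < 1 / (2 * q) := by positivity
  have h2q : 1 / (1 / (2 * (q : ℝ))) = 2 * q := by field_simp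
  have hm : 1 / (2 * (1 / (2 * (q : ℝ)))) ≤ (q : ℕ) := le_of_eq (by field_simp)
  have hlogq : 0 ≤ Real.log q := Real.log_nonneg (by exact_mod_cast hq)
  -- separation inside a set of diameter `≤ q/2`
  have hsepblock : ∀ (B : Finset ℕ), (∀ k ∈ B, ∀ k' ∈ B, (k : ℝ) - k' ≤ (q : ℝ) / 2) →
      ∀ k ∈ B, ∀ k' ∈ B, k ≠ k' →
        1 / (2 * (q : ℝ)) ≤ Vinogradov.distInt ((k : ℝ) * α - (k' : ℝ) * α) := by
    intro B hB k hk k' hk' hne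
    have hm0 : ((k : ℤ) - k' : ℤ) ≠ 0 := by
      intro h
      apply hne
      exact_mod_cast (sub_eq_zero.mp h)
    have habs : |(((k : ℤ) - k' : ℤ) : ℝ)| ≤ q / 2 := by
      rw [abs_le]; push_cast
      constructor <;> linarith [hB k' hk' k hk, hB k hk k' hk']
    have h := Vinogradov.le_distInt_mul_of_abs_le hq hcop hα hm0 habs
    push_cast at h
    have heq : (k : ℝ) * α - (k' : ℝ) * α = α * ((k : ℝ) - k') := by ring
    rw [heq]
    exact h
  -- decomposition into blocks `j = ⌊k/L⌋`
  have hmaps : ∀ k ∈ Icc 1 U, k / L ∈ range (U / L + 1) := by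
    intro k hk
    rw [Finset.mem_range, Nat.lt_add_one_iff]
    exact Nat.div_le_div_right (Finset.mem_Icc.mp hk).2
  rw [← Finset.sum_fiberwise_of_maps_to hmaps]
  have hbound : ∀ j ∈ range (U / L + 1),
      ∑ k ∈ (Icc 1 U).filter (fun k => k / L = j), Vinogradov.geomBound V ((k : ℝ) * α) ≤
        2 * V + 2 * q * (1 + Real.log q) := by
    intro j _
    set B := (Icc 1 U).filter (fun k => k / L = j) with hB
    have hdiam : ∀ k ∈ B, ∀ k' ∈ B, (k : ℝ) - k' ≤ (q : ℝ) / 2 := by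
      intro k hk k' hk'
      have hkj : k / L = j := (Finset.mem_filter.mp hk).2
      have hk'j : k' / L = j := (Finset.mem_filter.mp hk').2
      have hk2 : k < j * L + L := by rw [← hkj]; exact Nat.lt_div_mul_add hLpos
      have hk1' : j * L ≤ k' := by rw [← hk'j]; exact Nat.div_mul_le_self k' L
      have e1 : (k : ℝ) + 1 ≤ j * L + L := by exact_mod_cast hk2
      have e2 : (j : ℝ) * L ≤ k' := by exact_mod_cast hk1'
      linarith
    have hsep := hsepblock B hdiam
    calc ∑ k ∈ B, Vinogradov.geomBound V ((k : ℝ) * α)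
        ≤ 2 * V + (1 / (1 / (2 * (q : ℝ)))) * (1 + Real.log (q : ℕ)) :=
          Vinogradov.sum_geomBound_le_of_separated B (fun k : ℕ => (k : ℝ) * α) hδ hm hsep hV
      _ = 2 * V + 2 * q * (1 + Real.log q) := by rw [h2q]
  have hcard : (((U / L + 1 : ℕ)) : ℝ) ≤ 2 * U / q + 1 := by
    push_cast
    have h1 : ((U / L : ℕ) : ℝ) ≤ (U : ℝ) / L := Nat.cast_div_le
    have h2 : (U : ℝ) / L ≤ 2 * U / q := by
      rw [div_le_div_iff₀ hL0 hq0]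
      nlinarith
    linarith
  have hB0 : 0 ≤ 2 * V + 2 * q * (1 + Real.log q) := by positivity
  calc ∑ j ∈ range (U / L + 1), ∑ k ∈ (Icc 1 U).filter (fun k => k / L = j),
        Vinogradov.geomBound V ((k : ℝ) * α)
      ≤ ∑ j ∈ range (U / L + 1), (2 * V + 2 * q * (1 + Real.log q)) := Finset.sum_le_sum hbound
    _ = (((U / L + 1 : ℕ)) : ℝ) * (2 * V + 2 * q * (1 + Real.log q)) := by
        rw [Finset.sum_const, Finset.card_range, nsmul_eq_mul]
    _ ≤ (2 * U / q + 1) * (2 * V + 2 * q * (1 + Real.log q)) :=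
        mul_le_mul_of_nonneg_right hcard hB0

/-- **Lemma 3.3 for the constant majorant on the minor arcs**: for `α ∈ 𝔪 = lichtmanMinorArcs W Q₁`
(`W > 0`, `Q₁ ≥ 1`), `U ≥ 0` and every `N`,
`∑_{1 ≤ n ≤ N} min(U, 1/(2‖nα‖)) ≤ 4NU/W + 2U + (4N + 2Q₁)(1 + log Q₁)`,
since the Dirichlet fraction of `α` has `W < q ≤ Q₁` (`exists_rat_of_mem_minorArcs`) — the printed
"`H/q + H/P + (P+q) log q ≪ H/W` since `q ∈ [W, H/W⁴]`" step, without a logarithm on the main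
term (compare `sum_geomBound_const_le_of_mem_minorArcs`). [cite: Lichtman2020, Lemma 3.3] -/
theorem sum_geomBound_const_le_of_mem_minorArcs_sharp {W Q₁ α U : ℝ} (hW : 0 < W) (hQ₁ : 1 ≤ Q₁)
    (hα : α ∈ lichtmanMinorArcs W Q₁) (hU : 0 ≤ U) (N : ℕ) :
    ∑ n ∈ Icc 1 N, Vinogradov.geomBound U ((n : ℝ) * α) ≤
      4 * N * U / W + 2 * U + (4 * N + 2 * Q₁) * (1 + Real.log Q₁) := by
  obtain ⟨a, q, hq1, hWq, hqQ, hgcd, hαq⟩ := exists_rat_of_mem_minorArcs hQ₁ hα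
  have hq0 : (0 : ℝ) < q := by exact_mod_cast hq1
  have hq1' : (1 : ℝ) ≤ q := by exact_mod_cast hq1
  have hN0 : (0 : ℝ) ≤ N := Nat.cast_nonneg N
  have hcop : IsCoprime a (q : ℤ) := Int.isCoprime_iff_gcd_eq_one.mpr hgcd
  have hα2 : |α - a / q| ≤ 1 / (q : ℝ) ^ 2 := by
    refine hαq.trans ?_
    rw [sq]
    exact one_div_le_one_div_of_le (by positivity) (mul_le_mul_of_nonneg_left hqQ hq0.le)
  have h := sum_geomBound_const_le_of_abs_le hq1 hcop hα2 hU N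
  refine h.trans ?_
  have hlogq : 0 ≤ Real.log q := Real.log_nonneg hq1'
  have hlogQ : Real.log q ≤ Real.log Q₁ := Real.log_le_log hq0 hqQ
  have hexp : (2 * (N : ℝ) / q + 1) * (2 * U + 2 * q * (1 + Real.log q)) =
      4 * N * U / q + 2 * U + (4 * N + 2 * q) * (1 + Real.log q) := by
    field_simp
    ring
  rw [hexp]
  have h2 : 4 * (N : ℝ) * U / q ≤ 4 * N * U / W :=
    div_le_div_of_nonneg_left (by positivity) hW hWq.le
  have h3 : (4 * (N : ℝ) + 2 * q) * (1 + Real.log q) ≤ (4 * N + 2 * Q₁) * (1 + Real.log Q₁) :=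
    mul_le_mul (by linarith) (by linarith) (by linarith) (by positivity)
  linarith

/-! ### The numeric heart of the sharpened block estimate -/

/-- The numeric heart of the sharpened block estimate: under the size relations of §3.1
(`2 ≤ W`, `1 ≤ d ≤ W`, `W³³/2 ≤ P ≤ Q₁ = H/W⁴`, `H ≤ X`, `log H ≤ W`), the quantity `M · 5HX · V` of
`core_block_bound`, with `M ≤ (X+H)/(dP)`, `U ≤ H/(dP) + 1`, `#Q ≤ 12P/log(2P)`,
`V ≤ #Q·U + 2#Q·S` and `S ≤ 8PU/W + 2U + (8P + 2Q₁)(1 + log Q₁)` (the log-free Vinogradov bound), is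
at most `5880 H²X²/(d²W log(2P))`. [folklore] -/
theorem block_numeric_bound_sharp {X H d W P Q₁ M U cQ S V : ℝ} (hW : 2 ≤ W) (hd : 1 ≤ d)
    (hdW : d ≤ W) (hP : W ^ 33 / 2 ≤ P) (hPQ : P ≤ Q₁) (hQ₁ : Q₁ = H / W ^ 4) (hHX : H ≤ X)
    (hlogH : Real.log H ≤ W)
    (hM0 : 0 ≤ M) (hM : M ≤ (X + H) / (d * P)) (hU : U ≤ H / (d * P) + 1)
    (hcQ0 : 0 ≤ cQ) (hlog : 0 < Real.log (2 * P)) (hcQ : cQ ≤ 12 * P / Real.log (2 * P))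
    (hS : S ≤ 4 * (2 * P) * U / W + 2 * U + (4 * (2 * P) + 2 * Q₁) * (1 + Real.log Q₁))
    (hV : V ≤ cQ * U + 2 * cQ * S) :
    M * (5 * H * X * V) ≤ 5880 * (H ^ 2 * X ^ 2 / (d ^ 2 * W * Real.log (2 * P))) := by
  have hW0 : 0 < W := by linarith
  have hW1 : 1 ≤ W := by linarith
  have hd0 : 0 < d := by linarith
  have hW32 : (2 : ℝ) ^ 32 ≤ W ^ 32 := pow_le_pow_left₀ (by norm_num) hW 32
  have hW20 : 0 < W ^ 2 := by positivity
  -- elementary size relations between the powers of `W`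
  have hdW2 : d * W ≤ W ^ 2 := by
    calc d * W ≤ W * W := mul_le_mul_of_nonneg_right hdW hW0.le
      _ = W ^ 2 := (sq W).symm
  have hP2W : 2 * W ≤ P := by
    have h1 : W * 4 ≤ W * W ^ 32 :=
      mul_le_mul_of_nonneg_left (by linarith [hW32, show (4 : ℝ) ≤ 2 ^ 32 by norm_num]) hW0.le
    have h2 : W ^ 33 = W * W ^ 32 := by ring
    linarith
  have hP0 : 0 < P := by linarith
  have hP1 : 1 < P := by linarith
  have hH : P * W ^ 4 ≤ H := by
    rw [hQ₁, le_div_iff₀ (by positivity)] at hPQ; exact hPQ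
  have hW4 : 4 * W ^ 2 ≤ W ^ 4 := by
    have h4 : W ^ 2 * 4 ≤ W ^ 2 * W ^ 2 :=
      mul_le_mul_of_nonneg_left (by nlinarith) hW20.le
    have h5 : W ^ 4 = W ^ 2 * W ^ 2 := by ring
    linarith
  have hH2dW : 2 * (d * W) ≤ H := by
    have h1 : 2 * (d * W) ≤ 2 * W ^ 2 := by linarith
    have h2 : 2 * W ^ 2 ≤ P * W ^ 4 := by nlinarith
    linarith
  have hH0 : 0 < H := by
    have : 0 < d * W := by positivity
    linarith
  have hX0 : 0 < X := by linarith
  have hQ0 : 0 < Q₁ := by linarith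
  have hQ1 : 1 < Q₁ := by linarith
  set R : ℝ := H / (d * W) with hR
  have hR0 : 0 < R := by positivity
  -- (1) `U ≤ R`
  have h1a : H / (d * P) ≤ R / 2 := by
    calc H / (d * P) ≤ H / (d * (2 * W)) :=
          div_le_div_of_nonneg_left hH0.le (by positivity) (mul_le_mul_of_nonneg_left hP2W hd0.le)
      _ = R / 2 := by rw [hR]; field_simp
  have h1b : 1 ≤ R / 2 := by
    rw [hR, le_div_iff₀ (by norm_num), le_div_iff₀ (by positivity)]
    linarith
  have hUR : U ≤ R := by linarith
  -- (2) `2P ≤ R`, `8PU/W ≤ 12R`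
  have h2P : 2 * P ≤ R := by
    rw [hR, le_div_iff₀ (by positivity)]
    have h3 : 2 * P * (d * W) ≤ 2 * P * W ^ 2 := mul_le_mul_of_nonneg_left hdW2 (by positivity)
    have h6 : 2 * P * W ^ 2 ≤ P * W ^ 4 := by nlinarith [hP0.le]
    linarith
  have hPU : P * U ≤ H / d + P := by
    calc P * U ≤ P * (H / (d * P) + 1) := mul_le_mul_of_nonneg_left hU hP0.le
      _ = H / d + P := by field_simp
  have h2a : 4 * (2 * P) * U / W ≤ 12 * R := by
    have h5 : 4 * (2 * P) * U / W = 8 * (P * U) / W := by ring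
    have h6 : 8 * (P * U) / W ≤ 8 * (H / d + P) / W :=
      div_le_div_of_nonneg_right (by linarith) hW0.le
    have h7 : 8 * (H / d + P) / W = 8 * R + 8 * P / W := by rw [hR]; field_simp
    have h8 : 8 * P / W ≤ 4 * R := by
      calc 8 * P / W ≤ 8 * P / 1 := div_le_div_of_nonneg_left (by positivity) one_pos hW1
        _ = 4 * (2 * P) := by ring
        _ ≤ 4 * R := by linarith
    linarith
  -- (3) `(8P + 2Q₁)(1 + log Q₁) ≤ 10R`
  have hlogQ0 : 0 ≤ Real.log Q₁ := Real.log_nonneg hQ1.le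
  have hlogQ : 1 + Real.log Q₁ ≤ W ^ 2 := by
    have hQH : Q₁ ≤ H := by
      rw [hQ₁]
      apply div_le_self hH0.le
      exact one_le_pow₀ hW1
    have h1 : Real.log Q₁ ≤ Real.log H := Real.log_le_log hQ0 hQH
    nlinarith
  have hQW : Q₁ * W ^ 2 ≤ R := by
    rw [hQ₁, hR, div_mul_eq_mul_div, div_le_div_iff₀ (by positivity) (by positivity)]
    have : H * W ^ 2 * (d * W) ≤ H * W ^ 2 * W ^ 2 := mul_le_mul_of_nonneg_left hdW2 (by positivity)
    calc H * W ^ 2 * (d * W) ≤ H * W ^ 2 * W ^ 2 := this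
      _ = H * W ^ 4 := by ring
  have h3a : (4 * (2 * P) + 2 * Q₁) * (1 + Real.log Q₁) ≤ 10 * R := by
    calc (4 * (2 * P) + 2 * Q₁) * (1 + Real.log Q₁) ≤ (10 * Q₁) * W ^ 2 :=
          mul_le_mul (by linarith) hlogQ (by linarith) (by positivity)
      _ = 10 * (Q₁ * W ^ 2) := by ring
      _ ≤ 10 * R := by linarith
  -- (4) `S ≤ 24R`, `V ≤ 49 cQ R ≤ 588 P R/log(2P)`
  have hS24 : S ≤ 24 * R := by linarith
  have hV1 : V ≤ 49 * cQ * R := by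
    have h10 : cQ * U ≤ cQ * R := mul_le_mul_of_nonneg_left hUR hcQ0
    have h11 : 2 * cQ * S ≤ 2 * cQ * (24 * R) := mul_le_mul_of_nonneg_left hS24 (by positivity)
    linarith
  have hV2 : V ≤ 588 * (P * R / Real.log (2 * P)) := by
    calc V ≤ 49 * cQ * R := hV1
      _ = cQ * (49 * R) := by ring
      _ ≤ 12 * P / Real.log (2 * P) * (49 * R) :=
          mul_le_mul_of_nonneg_right hcQ (by positivity)
      _ = 588 * (P * R / Real.log (2 * P)) := by field_simp; ring
  -- (5) `M ≤ 2X/(dP)` and assembly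
  have hM2 : M ≤ 2 * X / (d * P) := by
    refine hM.trans (div_le_div_of_nonneg_right (by linarith) (by positivity))
  have hB0 : 0 ≤ 588 * (P * R / Real.log (2 * P)) := by positivity
  calc M * (5 * H * X * V) ≤ M * (5 * H * X * (588 * (P * R / Real.log (2 * P)))) := by
        apply mul_le_mul_of_nonneg_left _ hM0
        exact mul_le_mul_of_nonneg_left hV2 (by positivity)
    _ ≤ 2 * X / (d * P) * (5 * H * X * (588 * (P * R / Real.log (2 * P)))) :=
        mul_le_mul_of_nonneg_right hM2 (by positivity)
    _ = 5880 * (H ^ 2 * X ^ 2 / (d ^ 2 * W * Real.log (2 * P))) := by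
        rw [hR]
        field_simp
        ring

/-! ### The error term of the Ramaré step, without the wasteful logarithm -/

/-- **The error term of the Ramaré step** (p. 9: "We may replace `𝟙_{p ∤ m}` with `1` … at a cost of
`O(HX/dP)`"): `2 ∑_k ∑_{p ∈ Ps} #windowDiv (dp²) H k ≤ 8 HX/(d√W)` when the elements of `Ps` are
primes `≥ P₁ ≥ W³³ ≥ √W` (`∑_{p ≥ P₁} 1/p² ≤ 2/P₁`; compare `ramare_error_le`, whose extra factor
`log H` is not needed). [cite: Lichtman2020, §3.1, p. 9] -/
theorem ramare_error_le_sharp {X d H : ℕ} {W P₁ : ℝ} (hW : 2 ≤ W) (hd : 1 ≤ d) (hP₁ : W ^ 33 ≤ P₁)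
    (hH : 1 ≤ H) (hHX : H ≤ X) (Ps : Finset ℕ) (hPs : ∀ p ∈ Ps, p.Prime)
    (hPsb : ∀ p ∈ Ps, P₁ ≤ (p : ℝ)) :
    2 * ∑ k ∈ Icc 1 X, ∑ p ∈ Ps, (#(windowDiv (d * p * p) H k) : ℝ) ≤
      8 * ((H : ℝ) * X / (d * Real.sqrt W)) := by
  have hW0 : 0 < W := by linarith
  have hW1 : 1 ≤ W := by linarith
  have hd0 : (0 : ℝ) < d := by exact_mod_cast hd
  have hH0 : (0 : ℝ) ≤ H := Nat.cast_nonneg H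
  have hHX' : (H : ℝ) ≤ X := by exact_mod_cast hHX
  have hP₁1 : 1 ≤ P₁ := le_trans (one_le_pow₀ hW1) hP₁
  have hP₁0 : 0 < P₁ := by linarith
  have hsqW : 0 < Real.sqrt W := Real.sqrt_pos.mpr hW0
  rw [Finset.sum_comm]
  have h1 : ∀ p ∈ Ps, ∑ k ∈ Icc 1 X, (#(windowDiv (d * p * p) H k) : ℝ) ≤
      (H : ℝ) * ((X : ℝ) + H) / d * (1 / (p : ℝ) ^ 2) := by
    intro p hp
    have hp1 := (hPs p hp).one_le
    have h := sum_card_windowDiv_le X H (d * p * p) (Nat.mul_pos (Nat.mul_pos hd hp1) hp1) hH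
    refine h.trans (le_of_eq ?_)
    have hp0 : (0 : ℝ) < p := by exact_mod_cast hp1
    push_cast
    field_simp
  have hA1 : 1 ≤ ⌈P₁⌉₊ := Nat.ceil_pos.mpr hP₁0
  have h2 : ∑ p ∈ Ps, 1 / ((p : ℝ) ^ 2) ≤ 2 / P₁ := by
    have h3 := sum_inv_sq_le_of_le Ps hA1 (fun p hp => Nat.ceil_le.mpr (hPsb p hp))
    exact h3.trans (div_le_div_of_nonneg_left (by norm_num : (0 : ℝ) ≤ 2) hP₁0 (Nat.le_ceil P₁))
  have hsqrtP₁ : Real.sqrt W ≤ P₁ := by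
    calc Real.sqrt W ≤ W := by
          rw [Real.sqrt_le_left (by linarith)]
          nlinarith
      _ ≤ W ^ 33 := le_self_pow₀ hW1 (by norm_num)
      _ ≤ P₁ := hP₁
  calc 2 * ∑ p ∈ Ps, ∑ k ∈ Icc 1 X, (#(windowDiv (d * p * p) H k) : ℝ)
      ≤ 2 * ∑ p ∈ Ps, (H : ℝ) * ((X : ℝ) + H) / d * (1 / (p : ℝ) ^ 2) :=
        mul_le_mul_of_nonneg_left (Finset.sum_le_sum h1) (by norm_num)
    _ = 2 * ((H : ℝ) * ((X : ℝ) + H) / d) * ∑ p ∈ Ps, 1 / (p : ℝ) ^ 2 := by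
        rw [← Finset.mul_sum]; ring
    _ ≤ 2 * ((H : ℝ) * ((X : ℝ) + H) / d) * (2 / P₁) :=
        mul_le_mul_of_nonneg_left h2 (by positivity)
    _ ≤ 2 * ((H : ℝ) * (2 * X) / d) * (2 / Real.sqrt W) := by
        apply mul_le_mul _ _ (by positivity) (by positivity)
        · apply mul_le_mul_of_nonneg_left _ (by norm_num)
          apply div_le_div_of_nonneg_right _ hd0.le
          nlinarith
        · exact div_le_div_of_nonneg_left (by norm_num) hsqW hsqrtP₁
    _ = 8 * ((H : ℝ) * X / (d * Real.sqrt W)) := by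
        field_simp
        ring

/-! ### One dyadic block, sharpened -/

/-- **One dyadic block on the minor arcs, sharpened**: for a block `Q` of primes in `[2^j, 2^{j+1})`
with `W³³/2 ≤ 2^j ≤ Q₁ = H/W⁴`, `log H ≤ W`, and `α ∈ 𝔪(W, Q₁)`,
`∑_k |G_j(k)| ≤ 94 · HX/(d√W) · (j+1)^{-1/2}` (`core_block_bound`, `sum_sum_geomBound_sub_le`, the
log-free Vinogradov lemma `sum_geomBound_const_le_of_mem_minorArcs_sharp`, Chebyshev's
`π(2P) ≤ 12P/log(2P)`, `block_numeric_bound_sharp`, `log(2·2^j) = (j+1) log 2`; compare `block_bound`,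
which carries `√(1 + 2 log H)`). [cite: Lichtman2020, §3.1, (3.3)–(3.6)] -/
theorem block_bound_sharp {X d H j : ℕ} {W Q₁ : ℝ} (hW : 2 ≤ W) (hd : 1 ≤ d) (hdW : (d : ℝ) ≤ W)
    (hQ₁ : Q₁ = H / W ^ 4) (hHX : H ≤ X) (hlogH : Real.log H ≤ W) (Q : Finset ℕ)
    (hQpr : ∀ p ∈ Q, p.Prime) (hQ : ∀ p ∈ Q, 2 ^ j ≤ p ∧ p < 2 * 2 ^ j)
    (hPW : W ^ 33 / 2 ≤ (2 : ℝ) ^ j) (hPQ : (2 : ℝ) ^ j ≤ Q₁) (hQ₁1 : 1 ≤ Q₁)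
    (c w : ℕ → ℂ) (hc : ∀ m, ‖c m‖ ≤ 1) (hw : ∀ p, ‖w p‖ ≤ 1)
    {α : ℝ} (hα : α ∈ lichtmanMinorArcs W Q₁) :
    ∑ k ∈ Icc 1 X, ‖∑ p ∈ Q, ∑ m ∈ windowDiv (d * p) H k,
        c m * w p * (𝐞 (((m * p : ℕ) : ℝ) * α) : ℂ)‖ ≤
      94 * ((H : ℝ) * X / (d * Real.sqrt W)) * (1 / Real.sqrt ((j : ℝ) + 1)) := by
  have hW0 : 0 < W := by linarith
  have hd1 : (1 : ℝ) ≤ d := by exact_mod_cast hd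
  have hHX' : (H : ℝ) ≤ X := by exact_mod_cast hHX
  have hP1 : 1 ≤ 2 ^ j := Nat.one_le_two_pow
  have hP0 : (0 : ℝ) < (2 : ℝ) ^ j := by positivity
  have hdP0 : (0 : ℝ) < (d : ℝ) * (2 : ℝ) ^ j := by positivity
  have hrhs0 : 0 ≤ 94 * ((H : ℝ) * X / (d * Real.sqrt W)) * (1 / Real.sqrt ((j : ℝ) + 1)) := by
    positivity
  -- the core estimate and the abbreviations `M, U, V, S`
  have hcore := core_block_bound (X := X) (H := H) hd hP1 Q hQ c w hc hw α
  set M : ℕ := (X + H - 1) / (d * 2 ^ j) with hMdef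
  set Un : ℕ := (H - 1) / (d * 2 ^ j) with hUndef
  set U : ℝ := (Un : ℝ) + 1 with hUdef
  have hU0 : 0 ≤ U := by positivity
  have hV1 := sum_sum_geomBound_sub_le Q hQ hU0 α
  have hV2 := sum_geomBound_const_le_of_mem_minorArcs_sharp hW0 hQ₁1 hα hU0 (2 * 2 ^ j)
  push_cast at hV2
  set V : ℝ := ∑ p₁ ∈ Q, ∑ p₂ ∈ Q, Vinogradov.geomBound U (((p₁ : ℝ) - p₂) * α) with hVdef
  set S : ℝ := ∑ n ∈ Icc (1 : ℕ) (2 * 2 ^ j), Vinogradov.geomBound U ((n : ℝ) * α) with hSdef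
  -- the hypotheses of the numeric lemma
  have hM : (M : ℝ) ≤ ((X : ℝ) + H) / ((d : ℝ) * (2 : ℝ) ^ j) := by
    rw [le_div_iff₀ hdP0]
    have h1 : M * (d * 2 ^ j) ≤ X + H - 1 := Nat.div_mul_le_self _ _
    have h2 : ((M * (d * 2 ^ j) : ℕ) : ℝ) ≤ ((X + H - 1 : ℕ) : ℝ) := by exact_mod_cast h1
    have h3 : ((X + H - 1 : ℕ) : ℝ) ≤ (X : ℝ) + H := by
      have : X + H - 1 ≤ X + H := Nat.sub_le _ _
      exact_mod_cast this
    push_cast at h2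
    linarith
  have hU : U ≤ (H : ℝ) / ((d : ℝ) * (2 : ℝ) ^ j) + 1 := by
    rw [hUdef, add_le_add_iff_right, le_div_iff₀ hdP0]
    have h1 : Un * (d * 2 ^ j) ≤ H - 1 := Nat.div_mul_le_self _ _
    have h2 : ((Un * (d * 2 ^ j) : ℕ) : ℝ) ≤ ((H - 1 : ℕ) : ℝ) := by exact_mod_cast h1
    have h3 : ((H - 1 : ℕ) : ℝ) ≤ (H : ℝ) := by exact_mod_cast Nat.sub_le H 1
    push_cast at h2
    linarith
  have hcQ0 : (0 : ℝ) ≤ (#Q : ℝ) := Nat.cast_nonneg _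
  have hS : S ≤ 4 * (2 * (2 : ℝ) ^ j) * U / W + 2 * U +
      (4 * (2 * (2 : ℝ) ^ j) + 2 * Q₁) * (1 + Real.log Q₁) := hV2
  have hV : V ≤ #Q * U + 2 * #Q * S := hV1
  have h2P2 : 2 ≤ 2 * 2 ^ j := by omega
  have h2P2' : (2 : ℝ) ≤ 2 * (2 : ℝ) ^ j := by
    have h1 : (1 : ℝ) ≤ (2 : ℝ) ^ j := one_le_pow₀ (by norm_num)
    linarith
  have hlog2P : 0 < Real.log (2 * (2 : ℝ) ^ j) := Real.log_pos (by linarith)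
  have hcard : (#Q : ℝ) ≤ 12 * (2 : ℝ) ^ j / Real.log (2 * (2 : ℝ) ^ j) := by
    have h1 : #Q ≤ Nat.primeCounting (2 * 2 ^ j) :=
      card_le_primeCounting_of_prime Q (fun p hp => ⟨hQpr p hp, (hQ p hp).2.le⟩)
    have h2 := primeCounting_le_six_mul_div_log h2P2
    push_cast at h2
    calc (#Q : ℝ) ≤ Nat.primeCounting (2 * 2 ^ j) := by exact_mod_cast h1
      _ ≤ 6 * ((2 * (2 : ℝ) ^ j) / Real.log (2 * 2 ^ j)) := h2
      _ = 12 * (2 : ℝ) ^ j / Real.log (2 * 2 ^ j) := by ring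
  have hnum := block_numeric_bound_sharp (X := (X : ℝ)) (H := (H : ℝ)) (d := (d : ℝ)) hW hd1 hdW
    hPW hPQ hQ₁ hHX' hlogH (Nat.cast_nonneg M) hM hU hcQ0 hlog2P hcard hS hV
  -- `√(5880 K/((j+1) log 2)) ≤ 94 √K/√(j+1)`
  have hlogeq : Real.log (2 * (2 : ℝ) ^ j) = ((j : ℝ) + 1) * Real.log 2 := by
    rw [← pow_succ', Real.log_pow]
    push_cast
    ring
  have hj0 : (0 : ℝ) < (j : ℝ) + 1 := by positivity
  have hsq : 5880 * ((H : ℝ) ^ 2 * (X : ℝ) ^ 2 / ((d : ℝ) ^ 2 * W * Real.log (2 * (2 : ℝ) ^ j))) ≤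
      (94 * ((H : ℝ) * X / (d * Real.sqrt W)) * (1 / Real.sqrt ((j : ℝ) + 1))) ^ 2 := by
    have hK0 : 0 ≤ (H : ℝ) ^ 2 * (X : ℝ) ^ 2 / ((d : ℝ) ^ 2 * W) := by positivity
    have hrhs : (94 * ((H : ℝ) * X / (d * Real.sqrt W)) * (1 / Real.sqrt ((j : ℝ) + 1))) ^ 2 =
        8836 / ((j : ℝ) + 1) * ((H : ℝ) ^ 2 * (X : ℝ) ^ 2 / ((d : ℝ) ^ 2 * W)) := by
      rw [mul_pow, mul_pow, div_pow, div_pow, mul_pow, mul_pow, one_pow,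
        Real.sq_sqrt hW0.le, Real.sq_sqrt hj0.le]
      field_simp
      ring
    have hlhs : 5880 * ((H : ℝ) ^ 2 * (X : ℝ) ^ 2 /
        ((d : ℝ) ^ 2 * W * Real.log (2 * (2 : ℝ) ^ j))) =
        5880 / Real.log (2 * (2 : ℝ) ^ j) * ((H : ℝ) ^ 2 * (X : ℝ) ^ 2 / ((d : ℝ) ^ 2 * W)) := by
      field_simp
    rw [hrhs, hlhs]
    apply mul_le_mul_of_nonneg_right _ hK0
    rw [div_le_div_iff₀ hlog2P hj0, hlogeq]
    have h4 := two_thirds_le_log_two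
    have h5 : ((j : ℝ) + 1) * (2 / 3) ≤ ((j : ℝ) + 1) * Real.log 2 :=
      mul_le_mul_of_nonneg_left h4 hj0.le
    nlinarith
  calc ∑ k ∈ Icc 1 X, ‖∑ p ∈ Q, ∑ m ∈ windowDiv (d * p) H k,
        c m * w p * (𝐞 (((m * p : ℕ) : ℝ) * α) : ℂ)‖ ≤ Real.sqrt ((M : ℝ) * (5 * H * X * V)) := hcore
    _ ≤ Real.sqrt (5880 * ((H : ℝ) ^ 2 * (X : ℝ) ^ 2 /
        ((d : ℝ) ^ 2 * W * Real.log (2 * (2 : ℝ) ^ j)))) := Real.sqrt_le_sqrt hnum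
    _ ≤ Real.sqrt ((94 * ((H : ℝ) * X / (d * Real.sqrt W)) *
        (1 / Real.sqrt ((j : ℝ) + 1))) ^ 2) := Real.sqrt_le_sqrt hsq
    _ = 94 * ((H : ℝ) * X / (d * Real.sqrt W)) * (1 / Real.sqrt ((j : ℝ) + 1)) :=
        Real.sqrt_sq hrhs0

/-! ### The minor arc bound at a fixed `X`, sharpened -/

/-- **The minor arc bound of §3.1 at a fixed `X` (discrete form), in the strength of display (3.1).**
Let `2 ≤ W`, `1 ≤ d ≤ W`, `P₁ = W³³`, `Q₁ = H/W⁴ < P₂`, `3 ≤ H ≤ X`, `log H ≤ W`, `S(n) ⟺` (`n` has a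
prime factor in `[P₁, Q₁]` and one in `[P₂, Q₂]`), `g` completely multiplicative with `|g| ≤ 1`,
`α ∈ 𝔪(W, Q₁)`.  Then `∑_{k ≤ X} |∑_{n ∈ windowDiv d H k ∩ S} g(n) e(nα)| ≤ 384 · HX √(log H)/(d √W)`:
Ramaré's identity (`norm_twistedSum_sub_ramare_le`, error `ramare_error_le_sharp`), the dyadic blocks
`block_bound_sharp`, and `∑_{j ≤ J} (j+1)^{-1/2} ≤ 2√(J+1) ≤ 4√(log H)` (`J + 1 ≤ 3 log H`).
(The paper's (3.1), `≪ HX (log log X/(dW))^{1/2} ψ(X) = HX log H/((dW)^{1/2} (log log X)^{1/2})`,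
follows since `log log X ≤ d log H`; see `Lichtman2020_minorArcBound31_holds`.)
[cite: Lichtman2020, §3.1, (3.1)–(3.6)] -/
theorem minorArc_sum_le_sharp {X d H : ℕ} {W P₁ Q₁ P₂ Q₂ : ℝ} (hW : 2 ≤ W) (hd : 1 ≤ d)
    (hdW : (d : ℝ) ≤ W) (hP₁ : P₁ = W ^ 33) (hQ₁ : Q₁ = H / W ^ 4) (hQP : Q₁ < P₂)
    (hH : 3 ≤ H) (hHX : H ≤ X) (hlogH : Real.log H ≤ W) (S : ℕ → Prop) [DecidablePred S]
    (hSiff : ∀ n, S n ↔ HasPrimeFactorIn P₁ Q₁ n ∧ HasPrimeFactorIn P₂ Q₂ n)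
    (g : ℕ → ℂ) (hgmul : ∀ m n, g (m * n) = g m * g n) (hg : ∀ n, ‖g n‖ ≤ 1)
    {α : ℝ} (hα : α ∈ lichtmanMinorArcs W Q₁) :
    ∑ k ∈ Icc 1 X, ‖twistedSum g ((windowDiv d H k).filter S) α‖ ≤
      384 * ((H : ℝ) * X * Real.sqrt (Real.log H) / (d * Real.sqrt W)) := by
  classical
  -- basic real facts
  have hW0 : 0 < W := by linarith
  have hW1 : 1 ≤ W := by linarith
  have hH3 : (3 : ℝ) ≤ H := by exact_mod_cast hH
  have hH0 : (0 : ℝ) < H := by linarith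
  have hH1 : 1 ≤ H := by omega
  have hlogH1 : 1 ≤ Real.log H := by
    rw [Real.le_log_iff_exp_le hH0]
    have := Real.exp_one_lt_d9
    linarith
  have hsqlog1 : 1 ≤ Real.sqrt (Real.log H) := by
    rw [show (1 : ℝ) = Real.sqrt 1 from Real.sqrt_one.symm]
    exact Real.sqrt_le_sqrt hlogH1
  have hP₁1 : 1 ≤ P₁ := by rw [hP₁]; exact one_le_pow₀ hW1
  have hQ₁H : Q₁ ≤ H := by
    rw [hQ₁]
    exact div_le_self hH0.le (one_le_pow₀ hW1)
  -- the primes of `[P₁, Q₁]`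
  set Ps : Finset ℕ := (Finset.range (⌊Q₁⌋₊ + 1)).filter
    (fun p => p.Prime ∧ P₁ ≤ (p : ℝ) ∧ (p : ℝ) ≤ Q₁) with hPs_def
  have hPs : ∀ p ∈ Ps, p.Prime := fun p hp => (Finset.mem_filter.mp hp).2.1
  have hPsb : ∀ p ∈ Ps, P₁ ≤ (p : ℝ) ∧ (p : ℝ) ≤ Q₁ := fun p hp => (Finset.mem_filter.mp hp).2.2
  have hPsQ : ∀ p ∈ Ps, p ≤ ⌊Q₁⌋₊ := fun p hp => by
    have := Finset.mem_range.mp (Finset.mem_filter.mp hp).1; omega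
  have hS : ∀ n, S n → n ≠ 0 ∧ ∃ p ∈ Ps, p ∣ n := by
    intro n hn
    obtain ⟨⟨p, hp, hP, hQ⟩, -⟩ := (hSiff n).mp hn
    obtain ⟨hpr, hpn, hn0⟩ := Nat.mem_primeFactors.mp hp
    refine ⟨hn0, p, ?_, hpn⟩
    rw [hPs_def, Finset.mem_filter, Finset.mem_range]
    refine ⟨?_, hpr, hP, hQ⟩
    have : p ≤ ⌊Q₁⌋₊ := Nat.le_floor hQ
    omega
  have hS₂ : ∀ p ∈ Ps, ∀ m, m ≠ 0 → (S (m * p) ↔ HasPrimeFactorIn P₂ Q₂ m) := by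
    intro p hp m hm
    have hpr := hPs p hp
    obtain ⟨hP, hQ⟩ := hPsb p hp
    rw [hSiff]
    have h1 : HasPrimeFactorIn P₁ Q₁ (m * p) :=
      ⟨p, Nat.mem_primeFactors.mpr ⟨hpr, dvd_mul_left p m, Nat.mul_ne_zero hm hpr.ne_zero⟩, hP, hQ⟩
    have h2 : HasPrimeFactorIn P₂ Q₂ (m * p) ↔ HasPrimeFactorIn P₂ Q₂ m := by
      rw [mul_comm]
      apply hasPrimeFactorIn_mul_iff hpr.ne_zero
      intro q hq
      rw [Nat.Prime.primeFactors hpr, Finset.mem_singleton] at hq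
      rw [hq]; exact lt_of_le_of_lt hQ hQP
    rw [h2]
    exact ⟨fun h => h.2, fun h => ⟨h1, h⟩⟩
  -- the Ramaré coefficients and the dyadic blocks
  set c : ℕ → ℂ := fun m => if HasPrimeFactorIn P₂ Q₂ m then
    g m / ((#(Ps.filter (· ∣ m)) : ℂ) + 1) else 0 with hc
  have hcle : ∀ m, ‖c m‖ ≤ 1 := fun m => norm_ramareCoeff_le Ps (HasPrimeFactorIn P₂ Q₂) g hg m
  set J : ℕ := Nat.log 2 ⌊Q₁⌋₊ with hJ
  have hJ3 : (((J + 1 : ℕ)) : ℝ) ≤ 3 * Real.log H := log_two_floor_add_one_le hH hQ₁H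
  set Qj : ℕ → Finset ℕ := fun j => Ps.filter (fun p => Nat.log 2 p = j) with hQj_def
  have hQjP : ∀ j, ∀ p ∈ Qj j, p ∈ Ps := fun j p hp => (Finset.mem_filter.mp hp).1
  have hQj : ∀ j, ∀ p ∈ Qj j, 2 ^ j ≤ p ∧ p < 2 * 2 ^ j := by
    intro j p hp
    obtain ⟨hpP, hj⟩ := Finset.mem_filter.mp hp
    subst hj
    have hp0 : p ≠ 0 := (hPs p hpP).ne_zero
    refine ⟨Nat.pow_log_le_self 2 hp0, ?_⟩
    rw [← pow_succ']
    exact Nat.lt_pow_succ_log_self one_lt_two p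
  have hmaps : ∀ p ∈ Ps, Nat.log 2 p ∈ Finset.range (J + 1) := by
    intro p hp
    rw [Finset.mem_range, Nat.lt_succ_iff, hJ]
    exact Nat.log_mono_right (hPsQ p hp)
  set G : ℕ → ℕ → ℂ := fun j k => ∑ p ∈ Qj j, ∑ m ∈ windowDiv (d * p) H k,
      c m * g p * (𝐞 (((m * p : ℕ) : ℝ) * α) : ℂ) with hG
  -- Step 1: per-window decomposition
  have hdecomp : ∀ k ∈ Icc 1 X, ‖twistedSum g ((windowDiv d H k).filter S) α‖ ≤
      ∑ j ∈ Finset.range (J + 1), ‖G j k‖ +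
        2 * ∑ p ∈ Ps, (#(windowDiv (d * p * p) H k) : ℝ) := by
    intro k hk
    have hk1 : 1 ≤ k := (Finset.mem_Icc.mp hk).1
    have hR := norm_twistedSum_sub_ramare_le (d := d) (H := H) hk1 Ps hPs S
      (HasPrimeFactorIn P₂ Q₂) hS hS₂ g hgmul hg α c (fun m => rfl)
    have hmain : ∑ p ∈ Ps, ∑ m ∈ windowDiv (d * p) H k,
        c m * g p * (𝐞 (((m * p : ℕ) : ℝ) * α) : ℂ) = ∑ j ∈ Finset.range (J + 1), G j k := by
      simp only [hG, hQj_def]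
      exact (Finset.sum_fiberwise_of_maps_to hmaps _).symm
    calc ‖twistedSum g ((windowDiv d H k).filter S) α‖
        = ‖(twistedSum g ((windowDiv d H k).filter S) α -
            ∑ p ∈ Ps, ∑ m ∈ windowDiv (d * p) H k,
              c m * g p * (𝐞 (((m * p : ℕ) : ℝ) * α) : ℂ)) +
            ∑ j ∈ Finset.range (J + 1), G j k‖ := by rw [← hmain, sub_add_cancel]
      _ ≤ 2 * ∑ p ∈ Ps, (#(windowDiv (d * p * p) H k) : ℝ) +
            ∑ j ∈ Finset.range (J + 1), ‖G j k‖ :=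
          (norm_add_le _ _).trans (add_le_add hR (norm_sum_le _ _))
      _ = _ := by ring
  -- Step 2: the error term
  have herr := ramare_error_le_sharp (X := X) hW hd (le_of_eq hP₁.symm) hH1 hHX Ps hPs
    (fun p hp => (hPsb p hp).1)
  -- Step 3: the blocks
  have hY0 : 0 ≤ (H : ℝ) * X / (d * Real.sqrt W) := by positivity
  have hblock : ∀ j ∈ Finset.range (J + 1), ∑ k ∈ Icc 1 X, ‖G j k‖ ≤
      94 * ((H : ℝ) * X / (d * Real.sqrt W)) * (1 / Real.sqrt ((j : ℝ) + 1)) := by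
    intro j _
    rcases (Qj j).eq_empty_or_nonempty with hempty | ⟨p₀, hp₀⟩
    · -- empty block
      have h0 : ∀ k, G j k = 0 := fun k =>
        Finset.sum_eq_zero fun p hp => absurd hp (by rw [hempty]; exact Finset.notMem_empty p)
      rw [Finset.sum_eq_zero (fun k _ => by rw [h0 k, norm_zero])]
      positivity
    · -- a nonempty block: `2^j ≥ P₁/2`, `2^j ≤ Q₁`
      obtain ⟨hp₀P, -⟩ := hQj j p₀ hp₀
      obtain ⟨hp₀P₁, hp₀Q₁⟩ := hPsb p₀ (hQjP j p₀ hp₀)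
      have hPp₀ : (2 : ℝ) ^ j ≤ p₀ := by exact_mod_cast hp₀P
      have hPQ : (2 : ℝ) ^ j ≤ Q₁ := hPp₀.trans hp₀Q₁
      have hPW : W ^ 33 / 2 ≤ (2 : ℝ) ^ j := by
        have h2 : (p₀ : ℝ) < 2 * (2 : ℝ) ^ j := by exact_mod_cast (hQj j p₀ hp₀).2
        rw [← hP₁]; linarith
      have hQ₁1 : 1 ≤ Q₁ := hP₁1.trans (hp₀P₁.trans hp₀Q₁)
      exact block_bound_sharp hW hd hdW hQ₁ hHX hlogH (Qj j) (fun p hp => hPs p (hQjP j p hp))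
        (hQj j) hPW hPQ hQ₁1 c g hcle hg hα
  have hblocks : ∑ j ∈ Finset.range (J + 1), ∑ k ∈ Icc 1 X, ‖G j k‖ ≤
      376 * ((H : ℝ) * X * Real.sqrt (Real.log H) / (d * Real.sqrt W)) := by
    have hsqJ : Real.sqrt ((J + 1 : ℕ) : ℝ) ≤ 2 * Real.sqrt (Real.log H) := by
      calc Real.sqrt ((J + 1 : ℕ) : ℝ) ≤ Real.sqrt (4 * Real.log H) :=
            Real.sqrt_le_sqrt (by linarith)
        _ = Real.sqrt 4 * Real.sqrt (Real.log H) := Real.sqrt_mul (by norm_num) _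
        _ = 2 * Real.sqrt (Real.log H) := by
            rw [show (4 : ℝ) = 2 ^ 2 by norm_num, Real.sqrt_sq (by norm_num : (0 : ℝ) ≤ 2)]
    calc ∑ j ∈ Finset.range (J + 1), ∑ k ∈ Icc 1 X, ‖G j k‖
        ≤ ∑ j ∈ Finset.range (J + 1), 94 * ((H : ℝ) * X / (d * Real.sqrt W)) *
            (1 / Real.sqrt ((j : ℝ) + 1)) := Finset.sum_le_sum hblock
      _ = 94 * ((H : ℝ) * X / (d * Real.sqrt W)) *
            ∑ j ∈ Finset.range (J + 1), 1 / Real.sqrt ((j : ℝ) + 1) := by rw [Finset.mul_sum]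
      _ ≤ 94 * ((H : ℝ) * X / (d * Real.sqrt W)) * (2 * Real.sqrt ((J + 1 : ℕ) : ℝ)) :=
          mul_le_mul_of_nonneg_left (sum_inv_sqrt_le (J + 1)) (by positivity)
      _ ≤ 94 * ((H : ℝ) * X / (d * Real.sqrt W)) * (2 * (2 * Real.sqrt (Real.log H))) := by
          apply mul_le_mul_of_nonneg_left _ (by positivity)
          linarith
      _ = 376 * ((H : ℝ) * X * Real.sqrt (Real.log H) / (d * Real.sqrt W)) := by ring
  have herr' : 8 * ((H : ℝ) * X / (d * Real.sqrt W)) ≤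
      8 * ((H : ℝ) * X * Real.sqrt (Real.log H) / (d * Real.sqrt W)) := by
    apply mul_le_mul_of_nonneg_left _ (by norm_num)
    apply div_le_div_of_nonneg_right _ (by positivity)
    calc (H : ℝ) * X = (H : ℝ) * X * 1 := (mul_one _).symm
      _ ≤ (H : ℝ) * X * Real.sqrt (Real.log H) :=
          mul_le_mul_of_nonneg_left hsqlog1 (by positivity)
  -- assembly
  calc ∑ k ∈ Icc 1 X, ‖twistedSum g ((windowDiv d H k).filter S) α‖
      ≤ ∑ k ∈ Icc 1 X, (∑ j ∈ Finset.range (J + 1), ‖G j k‖ +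
          2 * ∑ p ∈ Ps, (#(windowDiv (d * p * p) H k) : ℝ)) := Finset.sum_le_sum hdecomp
    _ = ∑ j ∈ Finset.range (J + 1), ∑ k ∈ Icc 1 X, ‖G j k‖ +
          2 * ∑ k ∈ Icc 1 X, ∑ p ∈ Ps, (#(windowDiv (d * p * p) H k) : ℝ) := by
        rw [Finset.sum_add_distrib, Finset.sum_comm, Finset.mul_sum]
    _ ≤ 376 * ((H : ℝ) * X * Real.sqrt (Real.log H) / (d * Real.sqrt W)) +
          8 * ((H : ℝ) * X * Real.sqrt (Real.log H) / (d * Real.sqrt W)) :=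
        add_le_add hblocks (herr.trans herr')
    _ = 384 * ((H : ℝ) * X * Real.sqrt (Real.log H) / (d * Real.sqrt W)) := by ring

/-! ### The minor arc bound, eventually in `X` -/

/-- **The sharpened minor arc bound, eventually** (regime of Proposition 3.1 / (3.1): `A ≥ 2/3`,
`δ ≥ 0`, `ψ(X) = log H/log log X → ∞`, `H ≤ exp((log X)^{2/3})`): for `X` large, all
`1 ≤ d ≤ W = (log X)^A`, all completely multiplicative `|g| ≤ 1` and all `α ∈ 𝔪(W, H/W⁴)`,
`∫₀^X |∑_{x ≤ nd ≤ x+H, n ∈ S_d} g(n) e(nα)| dx ≤ 384 HX √(log H)/(d√W)` (discretised by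
`integral_window_div_eq_sum`, then `minorArc_sum_le_sharp`; `log H ≤ (log X)^{2/3} ≤ W` and
`Q₁ = H/W⁴ < H ≤ P₂` in the regime). [cite: Lichtman2020, Proposition 3.1 and (3.1)] -/
theorem minorArc_integral_le_sharp (A : ℝ) (hA : 2 / 3 ≤ A) (δ : ℝ) (hδ : 0 ≤ δ) (H : ℕ → ℕ)
    (hH : Tendsto (fun X : ℕ => Real.log (H X) / Real.log (Real.log X)) atTop atTop)
    (hHexp : ∀ᶠ X : ℕ in atTop, (H X : ℝ) ≤ Real.exp (Real.log X ^ (2 / 3 : ℝ))) :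
    ∀ᶠ X : ℕ in atTop, ∀ d : ℕ, 1 ≤ d → (d : ℝ) ≤ Real.log X ^ A →
      ∀ g : ℕ → ℂ, (∀ m n : ℕ, g (m * n) = g m * g n) → (∀ n : ℕ, ‖g n‖ ≤ 1) →
      ∀ α ∈ lichtmanMinorArcs (Real.log X ^ A) ((H X : ℝ) / Real.log X ^ (4 * A)),
        ∫ x in (0 : ℝ)..X,
            ‖twistedSum g ((Icc ⌈x / d⌉₊ ⌊(x + H X) / d⌋₊).filter (lichtmanTypical X A δ (H X))) α‖
          ≤ 384 * ((H X : ℝ) * X * Real.sqrt (Real.log (H X)) / (d * Real.sqrt (Real.log X ^ A))) := by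
  have hA0 : 0 < A := by linarith
  have hW2 : ∀ᶠ X : ℕ in atTop, 2 ≤ Real.log X ^ A :=
    ((tendsto_rpow_atTop hA0).comp tendsto_log_natCast).eventually_ge_atTop 2
  filter_upwards [hHexp, hW2, eventually_three_le_H hH, tendsto_log_natCast.eventually_ge_atTop 1,
    eventually_gt_atTop 0] with X hHX hW2X h3 hL1 hX0 d hd hdW g hgmul hg α hα
  have hX0' : (0 : ℝ) < X := by exact_mod_cast hX0
  have hL0 : 0 < Real.log X := by linarith
  set L : ℝ := Real.log X with hL
  set W : ℝ := L ^ A with hW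
  have hW0 : 0 < W := by rw [hW]; exact Real.rpow_pos_of_pos hL0 _
  have hH0 : (0 : ℝ) < H X := by
    have : (3 : ℝ) ≤ H X := by exact_mod_cast h3
    linarith
  -- the parameters of `minorArc_sum_le_sharp`
  have hP₁ : L ^ (33 * A) = W ^ 33 := by
    rw [hW, ← Real.rpow_natCast, ← Real.rpow_mul hL0.le]
    norm_num
    ring_nf
  have hW4 : L ^ (4 * A) = W ^ 4 := by
    rw [hW, ← Real.rpow_natCast, ← Real.rpow_mul hL0.le]
    norm_num
    ring_nf
  have hQ₁ : (H X : ℝ) / L ^ (4 * A) = (H X : ℝ) / W ^ 4 := by rw [hW4]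
  have hlogH : Real.log (H X) ≤ W := by
    have h1 : Real.log (H X) ≤ L ^ (2 / 3 : ℝ) := by
      have := Real.log_le_log hH0 hHX
      rwa [Real.log_exp] at this
    exact h1.trans (Real.rpow_le_rpow_of_exponent_le hL1 hA)
  have hHleX : H X ≤ X := by
    have h2 : L ^ (2 / 3 : ℝ) ≤ L := by
      calc L ^ (2 / 3 : ℝ) ≤ L ^ (1 : ℝ) := Real.rpow_le_rpow_of_exponent_le hL1 (by norm_num)
        _ = L := Real.rpow_one _
    have h3 : (H X : ℝ) ≤ X := by
      calc (H X : ℝ) ≤ Real.exp (L ^ (2 / 3 : ℝ)) := hHX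
        _ ≤ Real.exp L := Real.exp_le_exp.mpr h2
        _ = X := by rw [hL]; exact Real.exp_log hX0'
    exact_mod_cast h3
  have hQP : (H X : ℝ) / L ^ (4 * A) < Real.exp (L ^ (2 / 3 + δ / 2)) := by
    have h1 : (H X : ℝ) / L ^ (4 * A) < H X := by
      rw [hW4, div_lt_iff₀ (by positivity)]
      have hW41 : 1 < W ^ 4 := by
        have : (2 : ℝ) ^ 4 ≤ W ^ 4 := pow_le_pow_left₀ (by norm_num) hW2X 4
        linarith [show (16 : ℝ) = 2 ^ 4 by norm_num]
      nlinarith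
    have h2 : (H X : ℝ) ≤ Real.exp (L ^ (2 / 3 + δ / 2)) :=
      hHX.trans (Real.exp_le_exp.mpr (Real.rpow_le_rpow_of_exponent_le hL1 (by linarith)))
    linarith
  rw [integral_window_div_eq_sum (fun s => ‖twistedSum g (s.filter
    (lichtmanTypical X A δ (H X))) α‖) X (H X) d hd]
  exact minorArc_sum_le_sharp (P₁ := L ^ (33 * A)) (Q₂ := Real.exp (L ^ (1 - δ / 2))) hW2X hd hdW
    hP₁ hQ₁ hQP h3 hHleX hlogH (lichtmanTypical X A δ (H X)) (fun n => Iff.rfl) g hgmul hg hα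

end Literature.NumberTheory.Sieve.Lichtman2020

namespace Literature.NumberTheory.Sieve

open Lichtman2020

/-- **Display (3.1) of Lichtman 2020 (the minor arc bound as established in §3.1), PROVED**:
`∫₀^X |∑_{x ≤ nd ≤ x+H, n ∈ S_d} g(n) e(nα)| dx ≤ C · HX (log log X/(dW))^{1/2} ψ(X)` eventually,
uniformly in `1 ≤ d ≤ W = (log X)^A`, completely multiplicative `|g| ≤ 1` and `α ∈ 𝔪`, for every
`A > 5`, `δ ≥ 0` and `H` with `ψ(X) = log H/log log X → ∞`, `H ≤ exp((log X)^{2/3})`, with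
`C = 384`: by `minorArc_integral_le_sharp` the integral is at most `384 HX √(log H)/(d√W)`, and
`√(log H)/(d√W) ≤ (log log X/(dW))^{1/2} · (log H/log log X)` is equivalent to `log log X ≤ d log H`,
which holds once `ψ(X) ≥ 1`. [cite: Lichtman2020, (3.1)] -/
theorem Lichtman2020_minorArcBound31_holds : Lichtman2020_minorArcBound31 := by
  intro A hA δ hδ H hH hHexp
  have hA1 : 2 / 3 ≤ A := by linarith
  have hA0 : 0 < A := by linarith
  refine ⟨384, ?_⟩
  have hll : ∀ᶠ X : ℕ in atTop, 1 ≤ Real.log (Real.log X) :=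
    (Real.tendsto_log_atTop.comp tendsto_log_natCast).eventually_ge_atTop 1
  have hψ : ∀ᶠ X : ℕ in atTop, 1 ≤ Real.log (H X) / Real.log (Real.log X) :=
    tendsto_atTop.1 hH 1
  filter_upwards [minorArc_integral_le_sharp A hA1 δ hδ H hH hHexp, hll, hψ,
    tendsto_log_natCast.eventually_ge_atTop 1] with X hX hllX hψX hL1 d hd hdW g _hg1 hgmul hg α hα
  refine (hX d hd hdW g hgmul hg α hα).trans ?_
  set L : ℝ := Real.log X with hL
  set W : ℝ := L ^ A with hW
  set ℓ : ℝ := Real.log (Real.log X) with hℓ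
  set h : ℝ := Real.log (H X) with hh
  have hL0 : 0 < L := by linarith
  have hW0 : 0 < W := Real.rpow_pos_of_pos hL0 _
  have hℓ0 : 0 < ℓ := by linarith
  have hd1 : (1 : ℝ) ≤ d := by exact_mod_cast hd
  have hd0 : (0 : ℝ) < d := by linarith
  have hℓh : ℓ ≤ h := by
    rw [le_div_iff₀ hℓ0] at hψX
    linarith
  have hh0 : 0 < h := by linarith
  have hHX0 : 0 ≤ (H X : ℝ) * X := by positivity
  apply mul_le_mul_of_nonneg_left _ (by norm_num)
  rw [mul_div_assoc]
  apply mul_le_mul_of_nonneg_left _ hHX0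
  -- `√h/(d√W) ≤ √(ℓ/(dW)) · (h/ℓ)`, by comparing squares
  have hlhs0 : 0 ≤ Real.sqrt h / (d * Real.sqrt W) := by positivity
  have hrhs0 : 0 ≤ Real.sqrt (ℓ / (d * W)) * (h / ℓ) := by positivity
  rw [← pow_le_pow_iff_left₀ hlhs0 hrhs0 two_ne_zero, div_pow, mul_pow, mul_pow, div_pow,
    Real.sq_sqrt hh0.le, Real.sq_sqrt hW0.le, Real.sq_sqrt (by positivity : 0 ≤ ℓ / (d * W))]
  have heq : ℓ / (d * W) * (h ^ 2 / ℓ ^ 2) = h ^ 2 / (d * W * ℓ) := by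
    field_simp
  rw [heq, div_le_div_iff₀ (by positivity) (by positivity)]
  calc h * (d * W * ℓ) = (h * d * W) * ℓ := by ring
    _ ≤ (h * d * W) * h := mul_le_mul_of_nonneg_left hℓh (by positivity)
    _ = h ^ 2 * (d * W) := by ring
    _ ≤ h ^ 2 * (d ^ 2 * W) := by
        apply mul_le_mul_of_nonneg_left _ (by positivity)
        apply mul_le_mul_of_nonneg_right _ hW0.le
        nlinarith

end Literature.NumberTheory.Sieve
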